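import Summits.BirchSwinnertonDyer.Rank1Residual.Additive.LocalModelTransportKummer
import Summits.BirchSwinnertonDyer.Rank1Residual.Additive.GaloisCohomologyTorsionLevelBound
import Literature.NumberTheory.EllipticCurves.IwasawaSelmerControlLocalizationProofs
import HarnessLib

/-!
# Model transport in local Galois cohomology, III: the `ℤ_p`-tower (Kummer-on-`H_{E,∞}`)
# condition along `E' → E` (cell `b2b-bsdres`, CLASS-CLOSURE lane, class O10 — x1b GEN 41, class
# lead; file 103 of the series)

HONEST FRAMING (cell `b2b-bsdres`, run/shared/lean/b2b/bsd-rank1-residual/, verbatim in every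
file): the goal of the cell is to DELETE the COMBINATION-SHAPED residual classes of the
Birch–Swinnerton-Dyer formula for ALL analytic-rank `≤ 1` elliptic curves over `ℚ` — "full BSD
formula for every rank `≤ 1` curve in class `C`" assembled STRICTLY from published theorems — so
that the rank-`≤ 1` remainder becomes exactly the CONSTRUCTION-SHAPED classes, which are TYPED
(missing-input `Prop`s), NOT attempted. This is not "finishing BSD". CLASS-CLOSURE lane: prove
what is provable now; shrink each hard class to its core with data; no claim beyond stated classes;
research routes on CONSTRUCTION-SHAPED X12 / O10; census / instrument output = EVIDENCE / conjecture
items, NEVER a Literature fact; `RESIDUAL-MAP.md` marks change only by signed lines. THIS FILE: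
TOOL THEOREMS ONLY — no definition, no named Literature fact, no `sorry`, axioms standard; nothing
is booked; no label / mark / count / sub-cell moves; (C1_η), (C2_η-GZ), (C3_η) stay typed as filed
(cc-typer-6's pen); nothing about `BSD(W, p)` of any pair is claimed.

## What (files 101/102 continued)

The tower structure `𝓣` of the count (C) imposes at a finite place `v` the condition
"`loc_v c` dies in `H¹(H_{K_v,∞}, E(K̄_v))`" (`localTowerKer κ K_v 0` pulled back along
`H¹(Γ_{K_v}, E[p^m]) → H¹(Γ_{K_v}, E(K̄_v)) → H¹(H_{K_v,0}, E(K̄_v))`, files 72/84/99/100).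

* §1 **`comp_map_oneCocycleClass_mem_localTowerKer_iff`** (any `K`-field `E`; universe `Type`, as
  file 97 whose `coe_restrictField_torsionGaloisModule_apply` is reused): on a class `[φ]` of
  `H¹(Γ_E, E[n])` this condition reads **`∃ R ∈ E(Ē), ∀ u ∈ H_{E,∞}: ι_E(φ u) = u R − R`**
  (three `map_oneCocycleClass` and `oneCocycleClass_eq_zero_iff`).
* §2 **`exists_kummerOn_ker_of_transport`** — along a `K`-algebra map `E' → E` with `r : Γ_E → Γ_{E'}`
  onto and `E/E'` algebraic: if `Θ ξ'` (`Θ` a transport with cocycle description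
  `[σ ↦ τ ψ(r σ)]`, file 101) is represented by a cocycle which is Kummer on `H_{E,∞}`
  (`ι_E(φ u) = u R − R`), then EVERY cocycle `ψ` of `ξ'` is Kummer on `H_{E',∞}`:
  `ι_{E'}(ψ t) = t R' − R'` — change the representative by a coboundary `∂T`, push through
  `ι_E(τ • P) = J(ι_{E'} P)` (file 102), use `r(H_{E,∞}) ⊇ H_{E',∞}` (`res_{E'} ∘ r = τ⁻¹ res_E τ` and
  `ker κ ⊴ Γ_K`) and invert `J = Point.map j` (`j : Ē' ≃ Ē`).
  Consequence for the count: the minus line `Θ⁻¹(Σ_p)` at `ℚ_{v₀}` lies in `𝓣_{v₀}` (file 100's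
  hypothesis `hCT`), since minus classes are Kummer on the layer subgroups `H_{ℚ_p,n} ⊇ H_{ℚ_p,∞}`.

References: [GreenbergLNM1716] §3 p. 86; [SerreGaloisCohomology1997] I §2.4–2.5, II §1.1;
[MilneFT2022] Ch. 6–7.
-/

noncomputable section

open scoped Classical

open Field CategoryTheory WeierstrassCurve

namespace Summit.BirchSwinnertonDyer.Rank1Residual.Additive.LocalModelTransport

open Literature.NumberTheory.GaloisRepresentations Literature.NumberTheory.EllipticCurves
open scoped ContRepresentation

/-! ## §1 The tower condition on a cocycle -/

section TowerCondition

variable {K : Type} [Field K] (W : WeierstrassCurve K) {p : ℕ} [Fact p.Prime] (κ : ZpExtension K p)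
  (E : Type) [Field E] [Algebra K E]

/-- **The tower condition on a cocycle.** For a class `[φ] ∈ H¹(Γ_E, E[n])`, its image under
`H¹(Γ_E, E[n]) → H¹(Γ_E, E(Ē)) → H¹(H_{E,k}, E(Ē))` lies in the local tower kernel
`𝒦_{E,k} = ker(H¹(H_{E,k}, E(Ē)) → H¹(H_{E,∞}, E(Ē)))` iff **`φ` is Kummer on `H_{E,∞}`**:
`∃ R ∈ E(Ē), ∀ u ∈ H_{E,∞}, ι_E(φ u) = u • R − R`. [cite: GreenbergLNM1716, §3 p. 86]
[cite: SerreGaloisCohomology1997, I §2.4–2.5] -/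
theorem comp_map_oneCocycleClass_mem_localTowerKer_iff (k : ℕ) (n : ℤ)
    (φ : contOneCocycles (DiscreteGaloisModule.toTopRep
      (GaloisRep.restrictField E (W.torsionGaloisModule n)))) :
    ((resH1Hom (Literature.NumberTheory.EllipticCurves.subgroupIncl (localSubgroup (κ.layerSubgroup k) E))
          (AddMonoidHom.id (localPoints W E)) (fun _ _ ↦ rfl)).comp
        (galoisCohomology.map (W.torsionPointsMapIntertwining n E) 1)) (oneCocycleClass _ φ) ∈
        W.localTowerKer κ E k ↔
      ∃ R : localPoints W E, ∀ u ∈ localSubgroup κ.kerSubgroup E,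
        pointsMap W E ((φ.1 u : geomTorsion W n) : geomPoints W) = u • R - R := by
  rw [mem_localTowerKer_iff, AddMonoidHom.comp_apply]
  -- the three maps on the cocycle class, composed without rewriting in the goal
  have e1 := galoisCohomology.map_one_oneCocycleClass (W.torsionPointsMapIntertwining n E) φ
  have e2 := map_oneCocycleClass (discreteTopRep (absoluteGaloisGroup E) (localPoints W E))
    (Literature.NumberTheory.EllipticCurves.subgroupIncl (localSubgroup (κ.layerSubgroup k) E))
    (resHomOfEquivariant
      (Literature.NumberTheory.EllipticCurves.subgroupIncl (localSubgroup (κ.layerSubgroup k) E))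
      (AddMonoidHom.id (localPoints W E)) (fun _ _ ↦ rfl))
    (contOneCocycles.pullback (ContinuousMonoidHom.id (absoluteGaloisGroup E))
      (X := DiscreteGaloisModule.toTopRep (GaloisRep.restrictField E (W.torsionGaloisModule n)))
      (Y := (W.localGaloisModule E).toTopRep)
      (TopRep.ofHom ⟨(W.torsionPointsMapIntertwining n E).toContinuousLinearMap,
        (W.torsionPointsMapIntertwining n E).isIntertwining'⟩) φ)
  have e3 := map_oneCocycleClass
    (discreteTopRep (localSubgroup (κ.layerSubgroup k) E) (localPoints W E))
    (subgroupInclusion (localSubgroup_ker_le_layer κ E k))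
    (resHomOfEquivariant (subgroupInclusion (localSubgroup_ker_le_layer κ E k))
      (AddMonoidHom.id (localPoints W E)) (fun _ _ ↦ rfl))
    (contOneCocycles.pullback
      (Literature.NumberTheory.EllipticCurves.subgroupIncl (localSubgroup (κ.layerSubgroup k) E))
      (resHomOfEquivariant
        (Literature.NumberTheory.EllipticCurves.subgroupIncl (localSubgroup (κ.layerSubgroup k) E))
        (AddMonoidHom.id (localPoints W E)) (fun _ _ ↦ rfl))
      (contOneCocycles.pullback (ContinuousMonoidHom.id (absoluteGaloisGroup E))
        (X := DiscreteGaloisModule.toTopRep (GaloisRep.restrictField E (W.torsionGaloisModule n)))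
        (Y := (W.localGaloisModule E).toTopRep)
        (TopRep.ofHom ⟨(W.torsionPointsMapIntertwining n E).toContinuousLinearMap,
          (W.torsionPointsMapIntertwining n E).isIntertwining'⟩) φ))
  have key : Literature.NumberTheory.EllipticCurves.resOfLe (localPoints W E) (localSubgroup_ker_le_layer κ E k)
      (resH1Hom (Literature.NumberTheory.EllipticCurves.subgroupIncl (localSubgroup (κ.layerSubgroup k) E))
        (AddMonoidHom.id (localPoints W E)) (fun _ _ ↦ rfl)
        (galoisCohomology.map (W.torsionPointsMapIntertwining n E) 1 (oneCocycleClass _ φ))) =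
      oneCocycleClass _ _ :=
    ((congrArg (Literature.NumberTheory.EllipticCurves.resOfLe (localPoints W E)
      (localSubgroup_ker_le_layer κ E k)) ((congrArg (resH1Hom
        (Literature.NumberTheory.EllipticCurves.subgroupIncl (localSubgroup (κ.layerSubgroup k) E))
        (AddMonoidHom.id (localPoints W E)) (fun _ _ ↦ rfl)) e1).trans e2)).trans e3)
  refine ⟨fun h => ?_, fun h => key.trans ?_⟩
  · obtain ⟨R, hR⟩ := (oneCocycleClass_eq_zero_iff _ _).mp (key.symm.trans h)
    exact ⟨R, fun u hu => hR ⟨u, hu⟩⟩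
  · obtain ⟨R, hR⟩ := h
    exact (oneCocycleClass_eq_zero_iff _ _).mpr ⟨R, fun u => hR u.1 u.2⟩

end TowerCondition

/-! ## §2 Transport of the tower condition -/

section Transport

variable {K : Type} [Field K] (W : WeierstrassCurve K) {p : ℕ} [Fact p.Prime] (κ : ZpExtension K p)
  (E' E : Type) [Field E'] [Field E] [Algebra K E'] [Algebra K E] [Algebra E' E] [IsScalarTower K E' E]

/-- `Point.map id = id` on `E(Ē)` (Mathlib's `map_id` is stated for `Algebra.ofId`). [folklore] -/
theorem map_algHom_id_localPoints (R : localPoints W E) :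
    Affine.Point.map (W' := W) (AlgHom.id K (AlgebraicClosure E)) R = R := by
  change Affine.Point.map (W' := W) (AlgHom.id K (AlgebraicClosure E))
    (show (W.baseChange (AlgebraicClosure E)).toAffine.Point from R) = _
  rcases (show (W.baseChange (AlgebraicClosure E)).toAffine.Point from R) with _ | ⟨x, y, h⟩ <;> rfl

/-- `J = Point.map j : E(Ē') → E(Ē)` is onto when `E/E'` is algebraic (`j : Ē' ≃ Ē`,
the tree's `absClosureEquiv`). [folklore] -/
theorem exists_map_eq_localPoints [Algebra.IsAlgebraic E' E] (R : localPoints W E) :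
    ∃ R' : localPoints W E',
      Affine.Point.map (W' := W) ((absClosureEmbedding E' E).restrictScalars K) R' = R := by
  refine ⟨Affine.Point.map (W' := W)
    (((Literature.NumberTheory.GaloisRepresentations.absClosureEquiv E' E).restrictScalars K).symm :
      AlgebraicClosure E →ₐ[K] AlgebraicClosure E') R, ?_⟩
  have hcomp : ((absClosureEmbedding E' E).restrictScalars K).comp
      ((((Literature.NumberTheory.GaloisRepresentations.absClosureEquiv E' E).restrictScalars K).symm :
          AlgebraicClosure E ≃ₐ[K] AlgebraicClosure E') :
        AlgebraicClosure E →ₐ[K] AlgebraicClosure E') = AlgHom.id K (AlgebraicClosure E) :=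
    AlgHom.ext fun x => absClosureEmbedding_absClosureEquiv_symm E' E x
  change Affine.Point.map (W' := W) _ (Affine.Point.map (W' := W) _ R) = R
  rw [Affine.Point.map_map, hcomp]
  exact map_algHom_id_localPoints W E R

omit [IsScalarTower K E' E] in
/-- **`r(H_{E,∞}) ⊇ H_{E',∞}`, elementwise**: if `r u ∈ H_{E',∞}` then `u ∈ H_{E,∞}`
(`res_{E'}(r u) = τ⁻¹ res_E(u) τ` and `ker κ ⊴ Γ_K`). [cite: SerreGaloisCohomology1997, II §1.1] -/
theorem mem_localSubgroup_ker_of_absGaloisRestrict_mem {τ : absoluteGaloisGroup K}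
    (hτ : ∀ σ : absoluteGaloisGroup E,
      absGaloisRestrict K E' (absGaloisRestrict E' E σ) = τ⁻¹ * absGaloisRestrict K E σ * τ)
    {u : absoluteGaloisGroup E} (hu : absGaloisRestrict E' E u ∈ localSubgroup κ.kerSubgroup E') :
    u ∈ localSubgroup κ.kerSubgroup E := by
  rw [mem_localSubgroup_iff, resGal_eq_absGaloisRestrict] at hu ⊢
  rw [hτ u] at hu
  have h := (inferInstance : κ.kerSubgroup.Normal).conj_mem _ hu τ
  rwa [← mul_assoc, ← mul_assoc, mul_inv_cancel, one_mul, mul_assoc, mul_inv_cancel, mul_one] at h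

omit [IsScalarTower K E' E] in
/-- **Kummer-on-`H_{E,∞}` descends along the transport.** `E' → E` a `K`-algebra map with
`r : Γ_E → Γ_{E'}` onto and `E/E'` algebraic, `τ` the comparison element (`ι_E ∘ τ = j ∘ ι_{E'}`,
`res_{E'} ∘ r = τ⁻¹ res_E τ`), `Θ` a transport with cocycle description `Θ[ψ] = [σ ↦ τ ψ(r σ)]`
(file 101). If `Θ[ψ]` is represented by a cocycle `φ` that is Kummer on `H_{E,∞}`
(`ι_E(φ u) = u R − R`), then **`ψ` is Kummer on `H_{E',∞}`**: `ι_{E'}(ψ t) = t R' − R'`.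
(Change `φ` by the coboundary `∂T` separating it from `σ ↦ τ ψ(r σ)`; push through
`ι_E(τ P) = J(ι_{E'} P)`, `J(r σ • Q) = σ • J Q` of file 102; lift `t = r u` with `u ∈ H_{E,∞}`;
invert `J`.) [cite: GreenbergLNM1716, §3 p. 86] [cite: SerreGaloisCohomology1997, I §2.4, II §1.1] -/
theorem kummerOn_ker_of_transport [IsScalarTower K E' E] [Algebra.IsAlgebraic E' E] (n : ℤ)
    {τ : absoluteGaloisGroup K}
    (hτemb : ∀ x : AlgebraicClosure K,
      absClosureEmbedding K E (τ • x) = absClosureEmbedding E' E (absClosureEmbedding K E' x))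
    (hτ : ∀ σ : absoluteGaloisGroup E,
      absGaloisRestrict K E' (absGaloisRestrict E' E σ) = τ⁻¹ * absGaloisRestrict K E σ * τ)
    (hr : Function.Surjective (absGaloisRestrict E' E))
    (Θ : galoisCohomology (GaloisRep.restrictField E' (W.torsionGaloisModule n)) 1 →+
      galoisCohomology (GaloisRep.restrictField E (W.torsionGaloisModule n)) 1)
    (hΘ : ∀ ψ : contOneCocycles (DiscreteGaloisModule.toTopRep
        (GaloisRep.restrictField E' (W.torsionGaloisModule n))),
      ∃ φ : contOneCocycles (DiscreteGaloisModule.toTopRep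
        (GaloisRep.restrictField E (W.torsionGaloisModule n))),
        oneCocycleClass _ φ = Θ (oneCocycleClass _ ψ) ∧
        ∀ σ : absoluteGaloisGroup E, φ.1 σ = (W.torsionGaloisModule n) τ (ψ.1 (absGaloisRestrict E' E σ)))
    (ψ : contOneCocycles (DiscreteGaloisModule.toTopRep
      (GaloisRep.restrictField E' (W.torsionGaloisModule n))))
    (φ : contOneCocycles (DiscreteGaloisModule.toTopRep
      (GaloisRep.restrictField E (W.torsionGaloisModule n))))
    (hφ : oneCocycleClass _ φ = Θ (oneCocycleClass _ ψ))
    {R : localPoints W E}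
    (hR : ∀ u ∈ localSubgroup κ.kerSubgroup E,
      pointsMap W E ((φ.1 u : geomTorsion W n) : geomPoints W) = u • R - R) :
    ∃ R' : localPoints W E', ∀ t ∈ localSubgroup κ.kerSubgroup E',
      pointsMap W E' ((ψ.1 t : geomTorsion W n) : geomPoints W) = t • R' - R' := by
  obtain ⟨φ₀, hφ₀, hφ₀σ⟩ := hΘ ψ
  -- `φ - φ₀ = ∂T`
  have h0 : oneCocycleClass _ (φ - φ₀) = 0 := by rw [oneCocycleClass_sub, hφ, hφ₀, sub_self]
  obtain ⟨T, hT⟩ := (oneCocycleClass_eq_zero_iff _ _).mp h0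
  have hT' : ∀ σ : absoluteGaloisGroup E,
      ((φ₀.1 σ : geomTorsion W n) : geomPoints W) =
        ((φ.1 σ : geomTorsion W n) : geomPoints W) -
          (absGaloisRestrict K E σ • (T : geomPoints W) - (T : geomPoints W)) := by
    intro σ
    have h1 : φ₀.1 σ = φ.1 σ - ((GaloisRep.restrictField E (W.torsionGaloisModule n)) σ T - T) := by
      have h := hT σ
      change φ.1 σ - φ₀.1 σ = (GaloisRep.restrictField E (W.torsionGaloisModule n)) σ T - T at h
      rw [← h]; abel
    rw [h1, AddSubgroupClass.coe_sub, AddSubgroupClass.coe_sub, SignedTwist.coe_restrictField_torsionGaloisModule_apply]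
  -- the corrected point `R₁ = R - ι_E T`
  set J := Affine.Point.map (W' := W) ((absClosureEmbedding E' E).restrictScalars K) with hJ
  have hJψ : ∀ u ∈ localSubgroup κ.kerSubgroup E,
      J (pointsMap W E' ((ψ.1 (absGaloisRestrict E' E u) : geomTorsion W n) : geomPoints W)) =
        u • (R - pointsMap W E (T : geomPoints W)) - (R - pointsMap W E (T : geomPoints W)) := by
    intro u hu
    rw [← pointsMap_smul_eq_map_pointsMap W E' E hτemb,
      ← Literature.NumberTheory.EllipticCurves.AddSubgroup.torsionBy.coe_smul]
    change pointsMap W E (((W.torsionGaloisModule n) τ (ψ.1 (absGaloisRestrict E' E u)) :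
      geomTorsion W n) : geomPoints W) = _
    rw [← hφ₀σ u, hT' u, map_sub, hR u hu, map_sub, ← resGal_eq_absGaloisRestrict, pointsMap_smul,
      smul_sub]
    abel
  -- invert `J` and lift `t = r u`
  obtain ⟨R', hR'⟩ := exists_map_eq_localPoints W E' E (R - pointsMap W E (T : geomPoints W))
  refine ⟨R', fun t ht => ?_⟩
  obtain ⟨u, rfl⟩ := hr t
  have hu : u ∈ localSubgroup κ.kerSubgroup E :=
    mem_localSubgroup_ker_of_absGaloisRestrict_mem κ E' E hτ ht
  apply Affine.Point.map_injective (W' := W) (f := (absClosureEmbedding E' E).restrictScalars K)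
  have h := hJψ u hu
  rw [hJ, ← hR'] at h
  refine h.trans ?_
  exact ((map_sub (Affine.Point.map (W' := W) ((absClosureEmbedding E' E).restrictScalars K))
    (absGaloisRestrict E' E u • R') R').trans
    (congrArg (· - Affine.Point.map (W' := W) ((absClosureEmbedding E' E).restrictScalars K) R')
      (map_smul_localPoints W E' E u R'))).symm

end Transport

end Summit.BirchSwinnertonDyer.Rank1Residual.Additive.LocalModelTransport

end
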